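import Summits.KontsevichZagierPeriods.KontsevichZagierPeriods.Theses.SymplecticScissors
import Literature.NumberTheory.Transcendental.AyoubPeriodSeries
import Literature.NumberTheory.Transcendental.AyoubPeriodSeriesKernel
import Literature.NumberTheory.Transcendental.AyoubPeriodSeriesLocalizing
import Summits.KontsevichZagierPeriods.KontsevichZagierPeriods.Theorems.SymplecticScissorsTypeAGenerationStubExactDlogAux
import Summits.KontsevichZagierPeriods.KontsevichZagierPeriods.Theorems.SymplecticScissorsTypeAGenerationStubCovPolyAux

/-!
# `TypeAGeneration` (stmt-KontsevichZagierPeriods-18392), line `Sketch`, stub `stub_covFaces_of`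
(V3): the two faces `z_j = 1`, `z_j = 0` of `f(H)`, `H = zᵢ(1 − z_j) + u(zᵢ) z_j`

Registered stub `stub_covFaces_of` of the crux `TypeAGeneration` (route SymplecticScissors, line
`Sketch` = card stokes-compiler), wave 3 = Ayoub 2015 Rem. 1.5 (change of variables in dimension one
inside type (a)), on top of `Literature/NumberTheory/Transcendental/AyoubPeriodSeries.lean`
(`AyoubRel.CSeries = ℂ[[z₀, z₁, …]]`, `AyoubRel.restrC l c = (·)|_{z_l = c}`) and of the landed face
calculus `…StubRestrCOneAux.lean` (`z_l = 1`: additive and multiplicative on `ℓ¹`),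
`…StubRestrCZero.lean` (`z_l = 0`: the coefficient slice), `…StubExactDlogAux.lean`,
`…StubCovPolyAux.lean` (the one-variable polynomial `u(zᵢ)`: summable, involves `zᵢ` only).

GIVEN the analytic package V0 (`stub_covSubstAnalytic`, the hypothesis of the implication), for a
polynomial `u` with `u(0) = 0`, a one-variable `f = Σ f_n zᵢⁿ` with room, `G = f(H)` and `V = f(u(zᵢ))`:

* `G|_{z_j = 0} = f` — coefficientwise: at `a_j = 0`, `G_a = Σ_{n ≤ |a|} f_n (Hⁿ)_a` (V0) and
  `(Hⁿ)_a = (zᵢⁿ)_a` since `z_j ∣ H − zᵢ ∣ Hⁿ − zᵢⁿ` (`v3_coeff_covH_pow`);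
* `G|_{z_j = 1} = V` — analytic: `(·)|_{z_j=1}` is additive and multiplicative on `ℓ¹`, so the partial
  sums `P_N = Σ_{n<N} f_n Hⁿ` restrict to `R_N = Σ_{n<N} f_n u(zᵢ)ⁿ` (`H|_{z_j=1} = u(zᵢ)`,
  `v3_restrC_one_covH`); `R_N → V` coefficientwise (eventually constant coefficients, `u(0) = 0`),
  while `|(G|_{z_j=1})_a − (R_N)_a| ≤ Σ_m |(G − P_N)_{a + m e_j}| ≤ N_ρ(G − P_N) → 0` by V0
  (`v3_restrC_one_eq_of_approx`).

Elementary bookkeeping (folklore); no definition is introduced.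
-/

noncomputable section

-- `Summit.KontsevichZagierPeriods.KontsevichZagierPeriods.…` is the tree's mandated layout (single-conjunct summit).
set_option linter.dupNamespace false

namespace Summit.KontsevichZagierPeriods.KontsevichZagierPeriods.TypeAGenerationLine

open Finsupp MvPowerSeries
open Literature.NumberTheory.Transcendental
open Literature.NumberTheory.Transcendental.AyoubRel

/-- The straight-line homotopy `H = zᵢ(1 − z_j) + u(zᵢ) z_j`. -/
local notation3 "covH[" i ", " j ", " u "]" =>
  ((X i : CSeries) * (1 - X j) + Polynomial.aeval (X i : CSeries) u * X j)

/-- The substitution family `zᵢ ↦ H`, `z_l ↦ z_l` (`l ≠ i`). -/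
local notation3 "covFam[" i ", " j ", " u "]" =>
  (fun l : ℕ => if l = i then covH[i, j, u] else (X l : CSeries))

/-- The substitution family `zᵢ ↦ u(zᵢ)`, `z_l ↦ z_l` (`l ≠ i`). -/
local notation3 "uFam[" i ", " u "]" =>
  (fun l : ℕ => if l = i then Polynomial.aeval (X i : CSeries) u else (X l : CSeries))

/-! ## `ℓ¹` bookkeeping -/

/-- `ℓ¹` is closed under scalar multiplication. [folklore] -/
theorem v3_summable_norm_coeff_smul (c : ℂ) {F : CSeries}
    (hF : Summable fun a : ℕ →₀ ℕ => ‖coeff a F‖) :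
    Summable fun a : ℕ →₀ ℕ => ‖coeff a (c • F)‖ := by
  refine (hF.mul_left ‖c‖).congr fun a => ?_
  rw [coeff_smul, norm_mul]

/-- `ℓ¹` is closed under negation. [folklore] -/
theorem v3_summable_norm_coeff_neg {F : CSeries} (hF : Summable fun a : ℕ →₀ ℕ => ‖coeff a F‖) :
    Summable fun a : ℕ →₀ ℕ => ‖coeff a (-F)‖ :=
  hF.congr fun a => by rw [map_neg, norm_neg]

/-- `ℓ¹` is closed under differences. [folklore] -/
theorem v3_summable_norm_coeff_sub {F G : CSeries} (hF : Summable fun a : ℕ →₀ ℕ => ‖coeff a F‖)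
    (hG : Summable fun a : ℕ →₀ ℕ => ‖coeff a G‖) :
    Summable fun a : ℕ →₀ ℕ => ‖coeff a (F - G)‖ := by
  rw [sub_eq_add_neg]
  exact s4_summable_norm_coeff_add hF (v3_summable_norm_coeff_neg hG)

/-- `ℓ¹` is closed under finite sums. [folklore] -/
theorem v3_summable_norm_coeff_sum {ι : Type*} (s : Finset ι) (F : ι → CSeries)
    (hF : ∀ k ∈ s, Summable fun a : ℕ →₀ ℕ => ‖coeff a (F k)‖) :
    Summable fun a : ℕ →₀ ℕ => ‖coeff a (∑ k ∈ s, F k)‖ := by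
  classical
  induction s using Finset.induction_on with
  | empty => simp
  | insert b s hb ih =>
    rw [Finset.sum_insert hb]
    exact s4_summable_norm_coeff_add (hF b (Finset.mem_insert_self b s))
      (ih fun k hk => hF k (Finset.mem_insert_of_mem hk))

/-- `1 ∈ ℓ¹`. [folklore] -/
theorem v3_summable_norm_coeff_one : Summable fun a : ℕ →₀ ℕ => ‖coeff a (1 : CSeries)‖ := by
  have h := s4_summable_norm_coeff_coe (1 : MvPolynomial ℕ ℂ)
  rwa [MvPolynomial.coe_one] at h

/-- Weighted `ℓ¹` with weights `≥ 1` is contained in `ℓ¹`. [folklore] -/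
theorem v3_summable_norm_coeff_of_weighted {F : CSeries} {w : (ℕ →₀ ℕ) → ℝ} (hw : ∀ b, 1 ≤ w b)
    (hF : Summable fun a : ℕ →₀ ℕ => ‖coeff a F‖ * w a) :
    Summable fun a : ℕ →₀ ℕ => ‖coeff a F‖ :=
  hF.of_nonneg_of_le (fun _ => norm_nonneg _) fun a =>
    le_mul_of_one_le_right (norm_nonneg _) (hw a)

/-! ## The face map `z_j = 1` on `ℓ¹`: negation, differences, finite sums -/

/-- `(-F)|_{z_j=1} = -(F|_{z_j=1})` (coefficientwise `tsum_neg`). [folklore] -/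
theorem v3_restrC_one_neg (j : ℕ) (F : CSeries) : restrC j 1 (-F) = -restrC j 1 F := by
  refine MvPowerSeries.ext fun a => ?_
  rw [map_neg, s4_coeff_restrC_one, s4_coeff_restrC_one]
  split_ifs with h
  · rw [← tsum_neg]
    exact tsum_congr fun n => by rw [map_neg]
  · rw [neg_zero]

/-- `(A − B)|_{z_j=1} = A|_{z_j=1} − B|_{z_j=1}` on `ℓ¹`. [folklore] -/
theorem v3_restrC_one_sub (j : ℕ) {A B : CSeries} (hA : Summable fun a : ℕ →₀ ℕ => ‖coeff a A‖)
    (hB : Summable fun a : ℕ →₀ ℕ => ‖coeff a B‖) :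
    restrC j 1 (A - B) = restrC j 1 A - restrC j 1 B := by
  rw [sub_eq_add_neg, s4_restrC_add j hA (v3_summable_norm_coeff_neg hB), v3_restrC_one_neg,
    ← sub_eq_add_neg]

/-- `(Σ_k F_k)|_{z_j=1} = Σ_k F_k|_{z_j=1}` on `ℓ¹`. [folklore] -/
theorem v3_restrC_one_sum (j : ℕ) {ι : Type*} (s : Finset ι) (F : ι → CSeries)
    (hF : ∀ k ∈ s, Summable fun a : ℕ →₀ ℕ => ‖coeff a (F k)‖) :
    restrC j 1 (∑ k ∈ s, F k) = ∑ k ∈ s, restrC j 1 (F k) := by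
  classical
  induction s using Finset.induction_on with
  | empty => rw [Finset.sum_empty, Finset.sum_empty, restrC_zero]
  | insert b s hb ih =>
    rw [Finset.sum_insert hb, Finset.sum_insert hb,
      s4_restrC_add j (hF b (Finset.mem_insert_self b s))
        (v3_summable_norm_coeff_sum s F fun k hk => hF k (Finset.mem_insert_of_mem hk)),
      ih fun k hk => hF k (Finset.mem_insert_of_mem hk)]

/-! ## The one-variable polynomial `u(zᵢ)` -/

/-- `u(zᵢ)` has constant coefficient `u(0)`. [folklore] -/
theorem v3_constantCoeff_aeval (i : ℕ) (u : Polynomial ℂ) :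
    constantCoeff (Polynomial.aeval (X i : CSeries) u) = u.eval 0 := by
  induction u using Polynomial.induction_on' with
  | add p q hp hq => rw [map_add, map_add, hp, hq, Polynomial.eval_add]
  | monomial n a =>
    rw [c3_aeval_monomial, map_mul, map_pow, constantCoeff_C, constantCoeff_X,
      Polynomial.eval_monomial]

/-- For `U` with zero constant coefficient, `(Uⁿ)_a = 0` once `n > |a|`. [folklore] -/
theorem v3_coeff_pow_eq_zero {U : CSeries} (hU : constantCoeff U = 0) {a : ℕ →₀ ℕ} {n : ℕ}
    (hn : degree a + 1 ≤ n) : coeff a (U ^ n) = 0 :=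
  coeff_eq_zero_of_constantCoeff_nilpotent (m := 1) (by rw [pow_one, hU]) (by omega)

/-! ## `H|_{z_j=1} = u(zᵢ)` and `Hⁿ ≡ zᵢⁿ (mod z_j)` -/

/-- **`H|_{z_j=1} = u(zᵢ)`** for `H = zᵢ(1 − z_j) + u(zᵢ) z_j` (`(·)|_{z_j=1}` is a ring homomorphism
on `ℓ¹ ∋ zᵢ, z_j, 1, u(zᵢ)`; `z_j ↦ 1`, `zᵢ ↦ zᵢ`, `u(zᵢ) ↦ u(zᵢ)`). [folklore] -/
theorem v3_restrC_one_covH {i j : ℕ} (hij : i ≠ j) (u : Polynomial ℂ) :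
    restrC j 1 covH[i, j, u] = Polynomial.aeval (X i : CSeries) u := by
  have hXi := c3_summable_X i
  have hXj := c3_summable_X j
  have h1 := v3_summable_norm_coeff_one
  have hU := c3_summable_aeval i u
  have h1X : Summable fun a : ℕ →₀ ℕ => ‖coeff a ((1 : CSeries) - X j)‖ :=
    v3_summable_norm_coeff_sub h1 hXj
  rw [s4_restrC_add j (s4_summable_norm_coeff_mul hXi h1X) (s4_summable_norm_coeff_mul hU hXj),
    s4_restrC_mul hXi h1X j, s4_restrC_mul hU hXj j, v3_restrC_one_sub j h1 hXj, s4_restrC_one,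
    s4_restrC_X j j, if_pos rfl, sub_self, mul_zero, zero_add, mul_one,
    d1_restrC_one_of_not_usesVar fun h => hij (c3_usesVar_aeval h).symm]

/-- `z_j ∣ Hⁿ − zᵢⁿ` (`H − zᵢ = z_j (u(zᵢ) − zᵢ)`), hence `(Hⁿ)_a = (zᵢⁿ)_a` at `a_j = 0`. [folklore] -/
theorem v3_coeff_covH_pow (i j : ℕ) (u : Polynomial ℂ) {a : ℕ →₀ ℕ} (ha : a j = 0) (n : ℕ) :
    coeff a (covH[i, j, u] ^ n) = coeff a ((X i : CSeries) ^ n) := by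
  have hd : (X j : CSeries) ∣ covH[i, j, u] - X i :=
    ⟨Polynomial.aeval (X i : CSeries) u - X i, by ring⟩
  have h := (X_dvd_iff.mp (hd.trans (sub_dvd_pow_sub_pow _ _ n))) a ha
  rwa [map_sub, sub_eq_zero] at h

/-! ## One-variable series -/

/-- A series involving only `zᵢ` has its coefficients on the axis `a = aᵢ eᵢ`. [folklore] -/
theorem v3_coeff_eq_zero_of_ne_single {f : CSeries} {i : ℕ} (hf : ∀ l : ℕ, UsesVar f l → l = i)
    {a : ℕ →₀ ℕ} (ha : a ≠ single i (a i)) : coeff a f = 0 := by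
  by_contra hne
  apply ha
  ext l
  by_cases hl : l = i
  · subst hl
    rw [single_eq_same]
  · rw [single_eq_of_ne hl]
    by_contra hal
    exact hl (hf l ⟨a, hal, hne⟩)

/-! ## The face `z_j = 0` -/

/-- **`G|_{z_j=0} = f`** whenever `G_a = Σ_{n ≤ |a|} f_n (Hⁿ)_a` for all `a` (V0's coefficient
formula), `f` involves only `zᵢ`, `i ≠ j`: at `a_j = 0`, `(Hⁿ)_a = [a = n eᵢ]`. [folklore] -/
theorem v3_face_zero {i j : ℕ} (hij : i ≠ j) (u : Polynomial ℂ) {f G : CSeries}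
    (hf : ∀ l : ℕ, UsesVar f l → l = i)
    (hG : ∀ a : ℕ →₀ ℕ, coeff a G = ∑ n ∈ Finset.range (degree a + 1),
      coeff (single i n) f * coeff a (covH[i, j, u] ^ n)) :
    restrC j 0 G = f := by
  classical
  refine MvPowerSeries.ext fun a => ?_
  rw [s8_coeff_restrC_zero]
  split_ifs with haj
  · rw [hG a]
    simp_rw [v3_coeff_covH_pow i j u haj, coeff_X_pow, mul_ite, mul_one, mul_zero]
    by_cases ha : a = single i (a i)
    · rw [Finset.sum_eq_single (a i)]
      · rw [if_pos ha, ← ha]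
      · intro k _ hk
        rw [if_neg]
        intro h
        apply hk
        rw [h, single_eq_same]
      · exact fun hk => (hk (Finset.mem_range.mpr (Nat.lt_succ_of_le (le_degree i a)))).elim
    · rw [v3_coeff_eq_zero_of_ne_single hf ha]
      refine Finset.sum_eq_zero fun k _ => ?_
      rw [if_neg]
      intro h
      apply ha
      rw [h, single_eq_same]
  · symm
    by_contra hne
    exact hij (hf j ⟨a, haj, hne⟩).symm

/-! ## The face `z_j = 1`: passing to the limit -/

/-- **Limit exchange for the face map `z_j = 1`.** If `G, P_N ∈ ℓ¹`, `P_N|_{z_j=1} = R_N`, every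
coefficient of `R_N` is eventually the corresponding coefficient of `V`, `V` does not involve `z_j`,
and `N_w(G − P_N) → 0` for a weight `w ≥ 1`, then `G|_{z_j=1} = V`: at `a_j = 0`,
`|(G|_{z_j=1})_a − (R_N)_a| = |Σ_m (G − P_N)_{a + m e_j}| ≤ N_w(G − P_N)`. [folklore] -/
theorem v3_restrC_one_eq_of_approx {j : ℕ} {G V : CSeries} {P R : ℕ → CSeries}
    {w : (ℕ →₀ ℕ) → ℝ} (hw : ∀ b, 1 ≤ w b)
    (hG : Summable fun b : ℕ →₀ ℕ => ‖coeff b G‖)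
    (hP : ∀ N, Summable fun b : ℕ →₀ ℕ => ‖coeff b (P N)‖)
    (hR : ∀ N, restrC j 1 (P N) = R N)
    (hRV : ∀ a : ℕ →₀ ℕ, ∃ N₀ : ℕ, ∀ N, N₀ ≤ N → coeff a (R N) = coeff a V)
    (hV : ¬ UsesVar V j)
    (happrox : ∀ ε : ℝ, 0 < ε → ∃ N₀ : ℕ, ∀ N, N₀ ≤ N → ∃ E : ℝ, E < ε ∧
      HasSum (fun b : ℕ →₀ ℕ => ‖coeff b (G - P N)‖ * w b) E) :
    restrC j 1 G = V := by
  refine MvPowerSeries.ext fun a => ?_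
  by_cases haj : a j = 0
  · refine eq_of_forall_dist_le fun ε hε => ?_
    rw [dist_eq_norm]
    obtain ⟨N₀, hN₀⟩ := happrox ε hε
    obtain ⟨N₁, hN₁⟩ := hRV a
    obtain ⟨E, hEε, hE⟩ := hN₀ (max N₀ N₁) (le_max_left _ _)
    set D : CSeries := G - P (max N₀ N₁) with hD
    have hD1 : Summable fun b : ℕ →₀ ℕ => ‖coeff b D‖ :=
      v3_summable_norm_coeff_of_weighted hw hE.summable
    have hw0 : ∀ b, 0 ≤ ‖coeff b D‖ * w b := fun b =>
      mul_nonneg (norm_nonneg _) (zero_le_one.trans (hw b))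
    have hsub : coeff a (restrC j 1 G) - coeff a V = coeff a (restrC j 1 D) := by
      rw [← hN₁ (max N₀ N₁) (le_max_right _ _), ← hR, ← map_sub, hD,
        v3_restrC_one_sub j hG (hP _)]
    rw [hsub, s4_coeff_restrC_one, if_pos haj]
    have hray : Summable fun m : ℕ => ‖coeff (a + single j m) D‖ := s4_summable_ray hD1 a j
    have hrayw : Summable ((fun b : ℕ →₀ ℕ => ‖coeff b D‖ * w b) ∘ fun m : ℕ => a + single j m) :=
      hE.summable.comp_injective (s4_ray_injective a j)
    refine le_of_lt ?_
    calc ‖∑' m : ℕ, coeff (a + single j m) D‖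
        ≤ ∑' m : ℕ, ‖coeff (a + single j m) D‖ := norm_tsum_le_tsum_norm hray
      _ ≤ ∑' m : ℕ, ((fun b : ℕ →₀ ℕ => ‖coeff b D‖ * w b) ∘ fun m : ℕ => a + single j m) m :=
          Summable.tsum_le_tsum (fun m => le_mul_of_one_le_right (norm_nonneg _) (hw _)) hray hrayw
      _ ≤ ∑' b : ℕ →₀ ℕ, ‖coeff b D‖ * w b :=
          tsum_comp_le_tsum_of_inj hE.summable hw0 (s4_ray_injective a j)
      _ = E := hE.tsum_eq
      _ < ε := hEε
  · rw [s4_coeff_restrC_one, if_neg haj]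
    symm
    by_contra hne
    exact hV ⟨a, haj, hne⟩

/-! ## Registered form -/

/-- **V3 — FACES of the substituted series, GIVEN V0** (`stub_covSubstAnalytic`, the hypothesis):
for a polynomial `u` with `u(0) = 0`, a one-variable `f` (variable `zᵢ`) with room and
`H = zᵢ(1 − z_j) + u(zᵢ) z_j`, `f(H)|_{z_j=1} = f(u(zᵢ))` (the face map `z_j = 1` is additive and
multiplicative on `ℓ¹`, `H|_{z_j=1} = u(zᵢ)`, and one passes to the limit in V0's `N_ρ`-convergent
partial sums `Σ_{n<N} f_n Hⁿ`, whose restrictions `Σ_{n<N} f_n u(zᵢ)ⁿ` converge coefficientwise to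
`f(u(zᵢ))`) and `f(H)|_{z_j=0} = f` (`Hⁿ ≡ zᵢⁿ (mod z_j)`, coefficientwise). [folklore] -/
theorem stub_covFaces_of :
    (∀ (i j : ℕ), i ≠ j → ∀ (u : Polynomial ℂ), u.eval 0 = 0 →
      ∀ (f : CSeries), (∀ l : ℕ, UsesVar f l → l = i) →
      ∀ (r : ℝ), 2 + (∑ n ∈ u.support, ‖u.coeff n‖) < r →
        Summable (fun a : ℕ →₀ ℕ => ‖MvPowerSeries.coeff a f‖ * r ^ degree a) →
        MvPowerSeries.HasSubst covFam[i, j, u] ∧ MvPowerSeries.HasSubst uFam[i, u] ∧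
        (∀ l : ℕ, UsesVar (MvPowerSeries.subst covFam[i, j, u] f) l → l = i ∨ l = j) ∧
        (∀ l : ℕ, UsesVar (MvPowerSeries.subst uFam[i, u] f) l → l = i) ∧
        (∀ a : ℕ →₀ ℕ, MvPowerSeries.coeff a (MvPowerSeries.subst covFam[i, j, u] f) =
          ∑ n ∈ Finset.range (degree a + 1),
            MvPowerSeries.coeff (Finsupp.single i n) f * MvPowerSeries.coeff a (covH[i, j, u] ^ n)) ∧
        (∀ a : ℕ →₀ ℕ, MvPowerSeries.coeff a (MvPowerSeries.subst uFam[i, u] f) =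
          ∑ n ∈ Finset.range (degree a + 1),
            MvPowerSeries.coeff (Finsupp.single i n) f *
              MvPowerSeries.coeff a (Polynomial.aeval (X i : CSeries) u ^ n)) ∧
        (∃ ρ : ℝ, 1 < ρ ∧ ∃ q : ℝ, q < r ∧
          (∃ Q : ℝ, Q ≤ q ∧ HasSum (fun a : ℕ →₀ ℕ =>
            ‖MvPowerSeries.coeff a (covH[i, j, u])‖ * a.prod fun _ n => ρ ^ n) Q) ∧
          (Summable fun a : ℕ →₀ ℕ =>
            ‖MvPowerSeries.coeff a (MvPowerSeries.subst covFam[i, j, u] f)‖ * a.prod fun _ n => ρ ^ n) ∧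
          (Summable fun a : ℕ →₀ ℕ =>
            ‖MvPowerSeries.coeff a (MvPowerSeries.subst uFam[i, u] f)‖ * a.prod fun _ n => ρ ^ n) ∧
          (∀ ε : ℝ, 0 < ε → ∃ N : ℕ, ∀ N' : ℕ, N ≤ N' → ∃ E : ℝ, E < ε ∧
            HasSum (fun a : ℕ →₀ ℕ => ‖MvPowerSeries.coeff a
              (MvPowerSeries.subst covFam[i, j, u] f -
                ∑ n ∈ Finset.range N', MvPowerSeries.coeff (Finsupp.single i n) f • covH[i, j, u] ^ n)‖ *
              a.prod fun _ n => ρ ^ n) E))) →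
    ∀ (i j : ℕ), i ≠ j → ∀ (u : Polynomial ℂ), u.eval 0 = 0 →
      ∀ (f : CSeries), (∀ l : ℕ, UsesVar f l → l = i) →
      ∀ (r : ℝ), 2 + (∑ n ∈ u.support, ‖u.coeff n‖) < r →
        Summable (fun a : ℕ →₀ ℕ => ‖MvPowerSeries.coeff a f‖ * r ^ degree a) →
        restrC j 1 (MvPowerSeries.subst covFam[i, j, u] f) = MvPowerSeries.subst uFam[i, u] f ∧
        restrC j 0 (MvPowerSeries.subst covFam[i, j, u] f) = f := by
  intro hV0 i j hij u hu f hf r hr hs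
  obtain ⟨-, -, -, hVuses, hcoeffG, hcoeffV, ρ, hρ, q, -, ⟨Q, -, hH⟩, hGw, -, happrox⟩ :=
    hV0 i j hij u hu f hf r hr hs
  refine ⟨?_, v3_face_zero hij u hf hcoeffG⟩
  have hw : ∀ b : ℕ →₀ ℕ, 1 ≤ b.prod fun _ n => ρ ^ n := fun b =>
    s4_one_le_weight (ρ := fun _ => ρ) (fun _ => hρ.le) b
  have hH1 : Summable fun b : ℕ →₀ ℕ => ‖coeff b covH[i, j, u]‖ :=
    v3_summable_norm_coeff_of_weighted hw hH.summable
  have hG1 : Summable fun b : ℕ →₀ ℕ => ‖coeff b (MvPowerSeries.subst covFam[i, j, u] f)‖ :=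
    v3_summable_norm_coeff_of_weighted hw hGw
  have hU0 : constantCoeff (Polynomial.aeval (X i : CSeries) u) = 0 := by
    rw [v3_constantCoeff_aeval, hu]
  have hP1 : ∀ N : ℕ, ∀ n ∈ Finset.range N,
      Summable fun b : ℕ →₀ ℕ => ‖coeff b (coeff (single i n) f • covH[i, j, u] ^ n)‖ :=
    fun N n _ => v3_summable_norm_coeff_smul _ (s4_summable_norm_coeff_pow hH1 n)
  refine v3_restrC_one_eq_of_approx (w := fun b : ℕ →₀ ℕ => b.prod fun _ n => ρ ^ n)
    (P := fun N => ∑ n ∈ Finset.range N, coeff (single i n) f • covH[i, j, u] ^ n)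
    (R := fun N => ∑ n ∈ Finset.range N,
      coeff (single i n) f • Polynomial.aeval (X i : CSeries) u ^ n)
    hw hG1 (fun N => v3_summable_norm_coeff_sum _ _ (hP1 N)) (fun N => ?_)
    (fun a => ⟨degree a + 1, fun N hN => ?_⟩) (fun h => hij (hVuses j h).symm) happrox
  · rw [v3_restrC_one_sum j _ _ (hP1 N)]
    refine Finset.sum_congr rfl fun n _ => ?_
    rw [restrC_smul, s4_restrC_pow hH1 j n, v3_restrC_one_covH hij u]
  · rw [hcoeffV a, map_sum]
    simp_rw [coeff_smul]
    symm
    refine Finset.sum_subset (Finset.range_subset_range.mpr hN) fun n _ hn => ?_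
    rw [Finset.mem_range, not_lt] at hn
    rw [v3_coeff_pow_eq_zero hU0 hn, mul_zero]

end Summit.KontsevichZagierPeriods.KontsevichZagierPeriods.TypeAGenerationLine
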